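import Summits.HodgeConjecture.HodgeConjecture.Theorems.R90S9InnerFormSec146Scope     -- ★ p862338 (p01): `IsKcSpherical`, `IsKcSphericalClass`, `RepPrimeSph`; cone ★ ed. 1 `RepPrimeClass`, `classOf`, `mPrime`
import Summits.HodgeConjecture.HodgeConjecture.Theorems.F0P3CompactTrivOfRecord        -- ★ p819716 (F0P3): `cptTriv₀`; cone ★ p819048 `F0P3ClassTokensOfRecord`: `Cls`, `cl`, `rep`, `mult`, `mult_cl`
import HarnessLib

/-!
# R90-TF · S9 «InnerForm-13.3.6 (c)» — DICTIONARY: the S9 class currency (`RepPrimeClass`, `classOf`, `Quotient.out`, `mPrime`, `IsKcSphericalClass`) IS F0P3's kit-of-record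
# class currency (`Cls`, `cl`, `rep`, `mult`, `cptTriv₀`) at `𝒢 = adelicGroupData L⁺ L c̄ 3 H` — definitionally for the first three, provably for the last two

Cell `hodgecm-mathlib`, crux H413 (`stmt-HodgeConjecture-24833`), route of record `HCCMUnconditional`; programme R90-TF, section S9 (base `R90-IF`), seat R90-IF-p02 (g0); finding of
R90-IF-p02 2026-09-04T22:14:19Z ((n2) of R90-IF-plan 22:09:55Z), promised bridge.  Helper file, lane `--supports stmt-HodgeConjecture-24833 --as helper`; theorems only (no
definition, no instance, no notation, no named fact, no `sorry`).

WHY: both ★ ed. 1 `InnerFormSec146.RepPrimeSetoid L H μA` (S9, p862078) and ★ `F0P3ClassTokensOfRecord.clsSetoid 𝒢 μ` (floor 0, p819048) are the setoid of UNITARY EQUIVALENCE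
`AreUnitarilyEquivalent P.space.toContRep Q.space.toContRep` on `DiscreteAutomorphicRep 𝒢 μ`; their quotients, class maps and `Quotient.out` representatives therefore agree by
`rfl`, and so the whole ★ F0P3 estate stated over `Cls (Gp L H) μ` — the class trace of record ★ `trGp₀` and its spectral-side law ★ `spectralSideGp₀_of_conv` («`T_{G′}(f′) =
Σ_{π′} m(π′) tr π′(f′)`», §14.5 p. 237), the trace factorisation ★ `traceFactorisation_of_archFinTraceSplit` (letter TF modulo `ArchFinTraceSplit`), the non-spherical vanishing ★
`trGp₀_tens₀_eq_zero_of_not_cptTriv₀`, law #12 ★ `flathDet₀U_of_ARCH` — is importable at the S9 carpet instance `Γ₀^{sph}` (scope ★ `RepPrimeSph`) WITHOUT transport.  The two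
non-definitional entries (`m′ = mult`, `cptTriv₀ ↔ IsKcSphericalClass`) are one induction on classes each.

## Contents (namespace `Summit.HodgeConjecture.HodgeConjecture.R90.S9.InnerFormSec146`)
* §1 `repPrimeClass_eq_cls`, `classOf_eq_cl`, `out_eq_rep` — `rfl`.
* §2 `mPrime_eq_mult` — `m′(π′)` (★ ed. 1, `Quotient.lift` of the multiplicity) `=` ★ `mult` (multiplicity of the representative `rep π′`).
* §3 `cptTriv₀_iff_isKcSpherical_rep`, `cptTriv₀_iff_isKcSphericalClass`, `cptTriv₀_classOf_iff` — F0P3's «`K_c` acts trivially on `rep c`» (★ `cptTriv₀`, subtype spelling) is the S9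
  scope predicate (★ `IsKcSphericalClass`, `∈`-spelling, any representative).
HONEST LABEL: HC_CM is proved only modulo the 7 printed citations (2 remaining named inputs: hLiu418 = stmt-HodgeConjecture-24832, h413 = stmt-HodgeConjecture-24833) until rung 0
closes; a dictionary proves no printed statement and moves no digit.

## References
[Rogawski1990] §14.5 p. 237 (the classes `π′` and `m(π′)`), §14.6 p. 244.  [Dixmier1977] §5.4, §13.1.3.  [BorelJacquet1979] §4.6.
-/

set_option autoImplicit false
-- the mandated namespace repeats `HodgeConjecture.HodgeConjecture`, as in every `Theorems/*.lean` of this sub-problem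
set_option linter.dupNamespace false

noncomputable section

open NumberField IsDedekindDomain MeasureTheory
open scoped Matrix ComplexOrder
open Literature.NumberTheory.Automorphic Literature.NumberTheory.Automorphic.UnitaryGroup
open Literature.NumberTheory.Automorphic.UnitaryGroup.CotangentForms (cmCompactFactor)
open Summit.HodgeConjecture.HodgeConjecture.Cruxes.H413.F0P3ClassTokensOfRecord (Cls cl rep mult cl_rep mult_cl)
open Summit.HodgeConjecture.HodgeConjecture.Cruxes.H413.F0P3CompactTrivOfRecord (cptTriv₀)

namespace Summit.HodgeConjecture.HodgeConjecture.R90.S9.InnerFormSec146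

section Classes

variable (L : Type) [Field L] [NumberField L] [IsCMField L] (H : Matrix (Fin 3) (Fin 3) L)
  (μA : Measure (adelicGroupData (↥(maximalRealSubfield L)) L (IsCMField.complexConj L) 3 H).automorphicQuotient)
  [(adelicGroupData (↥(maximalRealSubfield L)) L (IsCMField.complexConj L) 3 H).IsAutomorphicMeasure μA]

/-! ## §1 The definitional entries -/

/-- **`Rep′ = Cls₀`**: the S9 class type ★ `RepPrimeClass L H μA` IS F0P3's class type of record ★ `Cls (adelicGroupData L⁺ L c̄ 3 H) μA` (both the quotient of the discrete
automorphic representations by unitary equivalence) — definitionally. [cite: Rogawski1990, §14.5 p. 237] [cite: Dixmier1977, §5.4] -/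
theorem repPrimeClass_eq_cls : RepPrimeClass L H μA = Cls (adelicGroupData (↥(maximalRealSubfield L)) L (IsCMField.complexConj L) 3 H) μA :=
  rfl

/-- **`classOf = cl`** (definitionally). [cite: Rogawski1990, §14.5 p. 237] -/
theorem classOf_eq_cl (P : DiscreteAutomorphicRep (adelicGroupData (↥(maximalRealSubfield L)) L (IsCMField.complexConj L) 3 H) μA) :
    classOf L H μA P = cl (adelicGroupData (↥(maximalRealSubfield L)) L (IsCMField.complexConj L) 3 H) μA P :=
  rfl

/-- **`Quotient.out = rep`**: the representative of record of a class is the same on both sides (definitionally). [cite: Dixmier1977, §13.1.3] -/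
theorem out_eq_rep (π' : RepPrimeClass L H μA) :
    Quotient.out (s := RepPrimeSetoid L H μA) π' = rep (adelicGroupData (↥(maximalRealSubfield L)) L (IsCMField.complexConj L) 3 H) μA π' :=
  rfl

/-! ## §2 Multiplicities -/

/-- **`m′(π′) = mult π′`**: the S9 multiplicity ★ `mPrime` (descended along `classOf` by `Quotient.lift`) equals F0P3's ★ `mult` (read on the representative `rep π′`) — both are
`(multiplicity of any representative).toNat` (★ `mPrime_classOf`, ★ `mult_cl`). [cite: Rogawski1990, §14.5 p. 237] [cite: Dixmier1977, §5.4] -/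
theorem mPrime_eq_mult (π' : RepPrimeClass L H μA) :
    mPrime L H μA π' = mult (adelicGroupData (↥(maximalRealSubfield L)) L (IsCMField.complexConj L) 3 H) μA π' := by
  obtain ⟨P, rfl⟩ := classOf_surjective L H μA π'
  rw [mPrime_classOf, classOf_eq_cl, mult_cl]

end Classes

/-! ## §3 The scope predicate -/

section Scope

variable (L : Type) [Field L] [NumberField L] [IsCMField L] (ι : L →+* ℂ) (H : Matrix (Fin 3) (Fin 3) L) (T : GL (Fin 3) ℂ)
  (hT : (T : Matrix (Fin 3) (Fin 3) ℂ)ᴴ * H.map ι * (T : Matrix (Fin 3) (Fin 3) ℂ) = Literature.Geometry.ComplexHyperbolic.BallModel.J)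
  (μA : Measure (adelicGroupData (↥(maximalRealSubfield L)) L (IsCMField.complexConj L) 3 H).automorphicQuotient)
  [(adelicGroupData (↥(maximalRealSubfield L)) L (IsCMField.complexConj L) 3 H).IsAutomorphicMeasure μA]

/-- **`cptTriv₀ π′ ↔ IsKcSpherical (rep π′)`**: F0P3's «`K_c = cmCompactFactor` fixes every vector of the representative of record» (★ `cptTriv₀`, vectors as a subtype) is the S9 scope
predicate at that representative (★ `IsKcSpherical`, vectors by membership). [cite: Rogawski1990, §14.6 p. 244] [cite: BorelJacquet1979, §4.6] -/
theorem cptTriv₀_iff_isKcSpherical_rep (π' : RepPrimeClass L H μA) :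
    cptTriv₀ L ι H T hT μA π' ↔
      IsKcSpherical L ι H T hT μA (rep (adelicGroupData (↥(maximalRealSubfield L)) L (IsCMField.complexConj L) 3 H) μA π') :=
  ⟨fun h k hk v hv => h k hk ⟨v, hv⟩, fun h k hk v => h k hk v v.2⟩

/-- **`cptTriv₀ π′ ↔ IsKcSphericalClass π′`** — F0P3's guard of ★ `TraceFactorisation` ∕ ★ `trGp₀_tens₀_eq_zero_of_not_cptTriv₀` ∕ ★ `flathDet₀U_of_ARCH` IS membership in the S9 scope ★ `RepPrimeSph`
(the class predicate read at the representative `rep π′`, whose class is `π′`: ★ `cl_rep`, ★ `isKcSphericalClass_classOf`). [cite: Rogawski1990, §14.6 p. 244] [cite: BorelJacquet1979, §4.6] -/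
theorem cptTriv₀_iff_isKcSphericalClass (π' : RepPrimeClass L H μA) :
    cptTriv₀ L ι H T hT μA π' ↔ IsKcSphericalClass L ι H T hT μA π' := by
  rw [cptTriv₀_iff_isKcSpherical_rep, ← isKcSphericalClass_classOf L ι H T hT μA, classOf_eq_cl, cl_rep]

/-- **`cptTriv₀ [P] ↔ IsKcSpherical P`** for any discrete `P` (the two previous entries at `π′ := classOf P`). [cite: Rogawski1990, §14.6 p. 244] -/
theorem cptTriv₀_classOf_iff (P : DiscreteAutomorphicRep (adelicGroupData (↥(maximalRealSubfield L)) L (IsCMField.complexConj L) 3 H) μA) :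
    cptTriv₀ L ι H T hT μA (classOf L H μA P) ↔ IsKcSpherical L ι H T hT μA P := by
  rw [cptTriv₀_iff_isKcSphericalClass, isKcSphericalClass_classOf]

/-- **Every element of the scope `Rep′_sph` satisfies F0P3's guard `cptTriv₀`** (so the spherical branch of ★ `TraceFactorisation` fires on it). [cite: Rogawski1990, §14.6 p. 244] -/
theorem cptTriv₀_of_repPrimeSph (π' : RepPrimeSph L ι H T hT μA) : cptTriv₀ L ι H T hT μA π'.1 :=
  (cptTriv₀_iff_isKcSphericalClass L ι H T hT μA π'.1).2 π'.2

end Scope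

end Summit.HodgeConjecture.HodgeConjecture.R90.S9.InnerFormSec146

end
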